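import Summits.QuantumFields.BalabanUV.T4Continuum.Support.NE7AdmissibleFibreLHC
import HarnessLib

/-!
# NE7TorusChartDecoding — THE TORUS CHART AT A UNITARY BASE COVERS EVERY NEARBY UNITARY PERIODIC CONFIGURATION, WITH SMALL COORDINATES: for `X₀, X` unitary and
# `M`-periodic with `X` bondwise within `1∕4` of `X₀` (relative, on the period box), `X = chart_{X₀}(Φ_X)` with `Φ_X := skewPR M (relLog M X₀ X)` (its `𝔲(n)` chart
# coordinate), and `‖Φ_X‖ ≤ 2·δ` whenever the bondwise relative distance is `≤ δ ≤ 1∕4` — the DECODING half («chart ∘ coordinates = id») complementing gen 68's injectivity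
# `NE7AdmissibleFibreLHC.eq_of_skewPR_relLog_eq`; the brick that localises a moving minimiser INSIDE the chart at `U♯` for the two-sided Lipschitz ∕ Hölder-½ dependence of
# `U_k(V)` on `V` (ROAD-G113 §5ter)

Cell `pub-balaban`, rung (B)+1 sub-cell t4, lineage `b2b-balaban-t4-ne7-p1` (CRUX PROVER NE7 #1 = OWNER of BINDER row NE7), generation 113.  Memo
`t4/b2b-balaban-t4-ne7-p1-g113/ROAD-G113.md` §5ter.  Over [tree] `MatrixLog.exp_mlog` ∕ `norm_mlog_le_two_mul`, `B7Prop2Explicit.star_mlog_eq_neg`, the torus bookkeeping of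
`AveragingDeficitTorusChart` (`eq_wrap_add`, `periodic_smul_vec`, `skewP_of_mem`).
WHAT ([folklore]; 0 def, 0 sorry; generic `d`).  `norm_skewP_le` (`‖skewP Y‖ ≤ ‖Y‖`), **`chart_skewPR_relLog_eq`** (decoding), **`norm_skewPR_relLog_le`** (`‖Φ_X‖ ≤ 2δ`).
HONEST FRAMING (page 1): elementary matrix∕torus bookkeeping; nothing is asserted about Bałaban's minimisers; NOT NE7, NOT NE3; spine 0∕9; finite T⁴ rung (B)+1 — NOT infinite volume,
NOT mass gap, NOT BetaPertH, NOT Clay (continuum YM on T⁴ ⇐ BetaPertH ∧ nine spine estimates).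
-/

set_option autoImplicit false

open scoped BigOperators Matrix Matrix.Norms.L2Operator Topology
open NormedSpace Finset Set Filter

namespace Summit.QuantumFields.BalabanUV.T4Continuum.NE7TorusChartDecoding

open Literature.MathematicalPhysics.QuantumFieldTheory.Balaban1983to89
open B7Prop1Explicit B7Prop2Explicit MatrixLog UnitaryModel
open T4AveragingDeficitWall (IsUnitaryCfg)
open T4AveragingDeficitWallBoundary (IsPeriodicCfg)
open AveragingDeficitTransport (mem_U1_of_unitary)
open AveragingDeficitTorusChart (TDir redN chart chartDir skewP skewP_apply skewP_of_mem eq_wrap_add periodic_smul_vec redN_boxVec)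
open AveragingDeficitChartCalculus (relLog)
open AveragingDeficitTwoLevelPrep (skewSub mem_skewSub skewPF skewPR skewPF_apply)

noncomputable section

variable {d : ℕ} {n : Type*} [Fintype n] [DecidableEq n]

/-- `‖skewP Y‖ ≤ ‖Y‖` (`skewP Y = ½(Y − Y†)`, `‖Y†‖ = ‖Y‖`). [folklore] -/
theorem norm_skewP_le (Y : Matrix n n ℂ) : ‖skewP Y‖ ≤ ‖Y‖ := by
  rw [skewP_apply, norm_smul]
  have hs : ‖star Y‖ = ‖Y‖ := norm_star Y
  have h2 : ‖(2 : ℂ)⁻¹‖ = 1 / 2 := by simp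
  rw [h2]
  calc 1 / 2 * ‖Y - star Y‖ ≤ 1 / 2 * (‖Y‖ + ‖star Y‖) := by gcongr; exact norm_sub_le _ _
    _ = ‖Y‖ := by rw [hs]; ring

/-- **DECODING: `chart_{X₀}(skewPR (relLog X₀ X)) = X`** for `X₀, X` unitary `M`-periodic with `X` bondwise within `1∕4` of `X₀` on the period box (the unitary logarithm in the
ball is skew, `exp ∘ log = id`, periodicity). [folklore] -/
theorem chart_skewPR_relLog_eq [Nonempty n] {M : ℕ} [NeZero M] {X₀ X : Site d → Fin d → (Matrix n n ℂ)ˣ}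
    (hX₀u : IsUnitaryCfg X₀) (hXu : IsUnitaryCfg X) (hX₀P : IsPeriodicCfg X₀ (M : ℤ)) (hXP : IsPeriodicCfg X (M : ℤ))
    (hnear : ∀ (r : Fin d → Fin M) (κ : Fin d),
      ‖(((X₀ (boxVec M r) κ)⁻¹ : (Matrix n n ℂ)ˣ) : Matrix n n ℂ) * (X (boxVec M r) κ : Matrix n n ℂ) - 1‖ ≤ 1 / 4) :
    chart (ContinuousLinearMap.id ℝ (Matrix n n ℂ)) M X₀ ((skewPR M (relLog M X₀ X) : ↥(skewSub d n M)) : TDir d n M) = X := by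
  letI : CStarAlgebra (Matrix n n ℂ) := {}
  funext x κ
  set r : Fin d → Fin M := redN M x with hr
  set xt : Site d := boxVec M r with hxt
  -- periodicity: the values at `x` are the values at the box representative `x̃`
  have hwrap : x = xt + (M : ℤ) • (fun i => x i / (M : ℤ)) := by rw [hxt, hr]; exact eq_wrap_add M x
  have hper₀ : X₀ x κ = X₀ xt κ := by
    conv_lhs => rw [hwrap]
    exact periodic_smul_vec (f := fun z => X₀ z κ) (fun z i => hX₀P z i κ) _ _
  have hper : X x κ = X xt κ := by
    conv_lhs => rw [hwrap]
    exact periodic_smul_vec (f := fun z => X z κ) (fun z i => hXP z i κ) _ _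
  -- the relative bond variable at `x̃`: unitary, near `1`, with skew logarithm
  set W : (Matrix n n ℂ)ˣ := (X₀ xt κ)⁻¹ * X xt κ with hW
  have hWval : (W : Matrix n n ℂ) = (((X₀ xt κ)⁻¹ : (Matrix n n ℂ)ˣ) : Matrix n n ℂ) * (X xt κ : Matrix n n ℂ) := by rw [hW, Units.val_mul]
  have hWu : W ∈ unitaryUnits (Matrix n n ℂ) := (unitaryUnits _).mul_mem ((unitaryUnits _).inv_mem (hX₀u _ _)) (hXu _ _)
  have hn : ‖(W : Matrix n n ℂ) - 1‖ ≤ 1 / 4 := by rw [hWval]; exact hnear r κ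
  have hskew : mlog (W : Matrix n n ℂ) ∈ skewAdjoint (Matrix n n ℂ) := by
    rw [skewAdjoint.mem_iff]; exact star_mlog_eq_neg (mem_unitaryUnits.mp hWu) hn
  have hexpW : expUnit (mlog (W : Matrix n n ℂ)) = W := by
    apply Units.ext
    rw [val_expUnit]
    exact exp_mlog (by linarith)
  -- the chart value at `(x, κ)`
  have hcoord : (((skewPR M (relLog M X₀ X) : ↥(skewSub d n M)) : TDir d n M) r κ) = skewP (mlog (W : Matrix n n ℂ)) := by
    simp only [skewPR, ContinuousLinearMap.coe_codRestrict_apply, skewPF_apply, relLog]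
    rw [hWval]
  show X₀ x κ * expUnit ((ContinuousLinearMap.id ℝ (Matrix n n ℂ)) ((((skewPR M (relLog M X₀ X) : ↥(skewSub d n M)) : TDir d n M)) (redN M x) κ)) = X x κ
  rw [ContinuousLinearMap.id_apply, ← hr, hcoord, skewP_of_mem hskew, hexpW, hper₀, hper, hW]
  rw [mul_inv_cancel_left]

/-- **SMALL COORDINATES**: if `X` is bondwise within `δ ≤ 1∕4` of `X₀` on the period box then `‖skewPR M (relLog M X₀ X)‖ ≤ 2δ` (`‖log W‖ ≤ 2‖W − 1‖`, `‖skewP Y‖ ≤ ‖Y‖`, sup norm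
on the torus fields). [folklore] -/
theorem norm_skewPR_relLog_le [Nonempty n] {M : ℕ} [NeZero M] {X₀ X : Site d → Fin d → (Matrix n n ℂ)ˣ} {δ : ℝ} (hδ0 : 0 ≤ δ) (hδ : δ ≤ 1 / 4)
    (hnear : ∀ (r : Fin d → Fin M) (κ : Fin d),
      ‖(((X₀ (boxVec M r) κ)⁻¹ : (Matrix n n ℂ)ˣ) : Matrix n n ℂ) * (X (boxVec M r) κ : Matrix n n ℂ) - 1‖ ≤ δ) :
    ‖(skewPR M (relLog M X₀ X) : ↥(skewSub d n M))‖ ≤ 2 * δ := by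
  rw [Submodule.coe_norm]
  refine (pi_norm_le_iff_of_nonneg (by positivity)).mpr fun r => (pi_norm_le_iff_of_nonneg (by positivity)).mpr fun κ => ?_
  have hco : (((skewPR M (relLog M X₀ X) : ↥(skewSub d n M)) : TDir d n M) r κ)
      = skewP (mlog ((((X₀ (boxVec M r) κ)⁻¹ : (Matrix n n ℂ)ˣ) : Matrix n n ℂ) * (X (boxVec M r) κ : Matrix n n ℂ))) := by
    simp only [skewPR, ContinuousLinearMap.coe_codRestrict_apply, skewPF_apply, relLog]
  rw [hco]
  refine (norm_skewP_le _).trans ?_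
  have h := norm_mlog_le_two_mul (X := (((X₀ (boxVec M r) κ)⁻¹ : (Matrix n n ℂ)ˣ) : Matrix n n ℂ) * (X (boxVec M r) κ : Matrix n n ℂ))
    ((hnear r κ).trans (by linarith))
  linarith [hnear r κ]

end

end Summit.QuantumFields.BalabanUV.T4Continuum.NE7TorusChartDecoding
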